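import Mathlib.Tactic.LinearCombination
import Mathlib.Tactic.Ring
import Mathlib.Algebra.Group.Units.Basic
import Mathlib.Data.ZMod.Defs
import HarnessLib

/-!
# Venture HSemireg — the quintuple point of the zero-sum scheme at N = 9 (THEOREM M5's smallest cell, kernel form)

Kernel instance of THEOREM M5 of `widen/W3/W3-M3LOCAL-w3cm1.md` §1 (computation cell `pub-hsemireg`, W3
«special fibres», seat w3-cm-1; READ ×2: `W3-M5-READ-w3prym1.md`, `W3-M5-READ-w3prym2.md`; the r = 1 column of
THEOREM U, `THEOREM-U-ONEPAGE-w3prym1.md`) at its SMALLEST cell s = 3, N = 3s = 9 (n = 2, r = 1).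

THE CELL. Three depressed cubics `C_e = z³ + c_e z + d_e` (e = 0, 1, 2) with product
`P = z⁹ + p₇z⁷ + … + p₁z + p₀` (`prod_three_depressed_cubics`: `p₇ = e₁(c)`, `p₆ = e₁(d)`, `p₅ = e₂(c)`,
`p₄ = Σ_{e≠e'} c_e d_{e'}`, `p₃ = e₂(d) + e₃(c)`, `p₂ = Σ_e d_e c_{e+1} c_{e+2}`, `p₁ = Σ_e c_e d_{e+1} d_{e+2}`,
`p₀ = e₃(d)`). The zero-sum scheme `Y(3;6)` asks `p₇ = p₆ = p₅ = p₄ = p₃ = 0` (P ∈ z⁹ + ⟨z², z, 1⟩: the nine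
roots of P split into three zero-sum triples), and the TRANSVERSAL SLICE through the μ₃-point `P₀ = z⁹ + 1`
fixes `p₀ = 1`. At `P₀` the configuration is `c = 0`, `d = (1, ζ, ζ²)` (ζ a primitive cube root of unity). By
the étale chart of M3LOCAL §1 STEP 1 (multiplication of pairwise coprime monic polynomials is étale), the
transversal fat point `Z = Y(3;6) ∩ {p₀ = 1}` at `P₀` IS the germ at `(0, (1,ζ,ζ²))` of the affine scheme
`X = {f₁ = … = f₆ = 0} ⊂ 𝔸⁶_{c,d}`, `f₁ = e₁(c)`, `f₂ = e₂(c)`, `f₃ = e₁(d)`, `f₄ = Σ_{e≠e'} c_e d_{e'}`,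
`f₅ = e₂(d) + e₃(c)`, `f₆ = e₃(d) − 1`. THEOREM M5 (every n ≥ 2; here n = 2): `Z ≅ Spec K[t]/(t⁵)`, with
`p₂ = κ p₁²`, `κ = (N−3)/(2N)` (= 1/3 at N = 9), and `p₁` of order exactly 5.

WHAT THE KERNEL CHECKS HERE (polynomial identities in a commutative ring `R`; `ζ` with `ζ² + ζ + 1 = 0`; `th`
with `3·th = 1`, i.e. 3 invertible — no field, no power series, no scheme is needed):
* `dict_f1` … `dict_f6` — in the μ₃-EIGENCOORDINATES `c_e = γ + ζ^e x + ζ^{-e} x'`,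
  `d_e = ζ^e (1 + y) + β + ζ^{-e} y'` (an invertible linear change of coordinates when 3 is a unit:
  `dict_inv_*`), the six generators become
  `f₁ = 3γ`, `f₂ = 3γ² − 3xx'`, `f₃ = 3β`, `f₄ = 6γβ − 3xy' − 3x'(1+y)`,
  `f₅ = 3β² − 3(1+y)y' + γ³ + x³ + x'³ − 3γxx'`, `f₆ = β³ + (1+y)³ + y'³ − 3β(1+y)y' − 1`;
* `solved_form` — in ANY commutative ring in which `3`, `1 + y` and `3 + 3y + y²` are units (the last two are
  units in the local ring at the point, where `y ∈ 𝔪`), the six equations force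
  `γ = 0, β = 0, y = 0, x'² = 0, x⁵ = 0, 3y' = x³, 3x' = −x⁴` — every coordinate is a polynomial in `x`, and
  `x⁵ = 0`;
* `model_f1` … `model_f6`, `model_units` — conversely the Λ-point `(γ, x, x', β, y, y') = (0, t, −t⁴/3, 0, 0, t³/3)`
  solves the six equations in any ring with `t⁵ = 0` (the closed immersion `Spec K[t]/(t⁵) ↪ Z` of THEOREM U's
  proof, written out at this cell), and `solution_eq_model` — a nearby solution is the model point at `t = x`;
* `model_product` — the same point as THREE EXPLICIT CUBICS: `∏_e (z³ + c_e(t)z + d_e(t)) = z⁹ + 3t²z² + 3tz + 1`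
  modulo `(ζ²+ζ+1, 3th−1, t⁵)` — an honest zero-sum splitting over `R[t]/(t⁵)`; `model_p1`, `model_p2` — on it `p₁ = 3t`, `p₂ = 3t²`: so `p₂ = p₁²/3 = κ·p₁²` with `κ = (N − 3)/(2N) = 1/3`
  (M5's forced second-order class at N = 9, `kappa_N9`) and `p₁⁵ = 0`, `p₁⁴ = 81 t⁴`;
* `witness_mod_7_pow_5` — NON-VACUITY by `decide` in `ℤ/7⁵` (t = 7, t⁵ = 0, t⁴ ≠ 0, ζ = 1353, 1/3 = 11205):
  the explicit configuration `c = (4809, 11872, 126)`, `d = (11320, 3411, 2076)` satisfies `f₁ = … = f₆ = 0`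
  with `p₁ = 21 = 3t`, `p₂ = 147 = 3t²`, i.e. `∏_e (z³ + c_e z + d_e) = z⁹ + 147 z² + 21 z + 1` in `(ℤ/7⁵)[z]`
  — a zero-sum splitting to order t⁴ that no order-≤ 4 equation kills.
Together (three lines of commutative algebra, NOT formalised here): the functor of points of the germ of `X`
at `(0, (1,ζ,ζ²))` on rings with 1/3 is `t ↦ {t : t⁵ = 0}`, i.e. the local ring of `Z` is `K[t]/(t⁵)` —
multiplicity EXACTLY 5, embedding dimension 1, `p₂ = p₁²/3` — THEOREM M5 at N = 9, over every field of
characteristic ≠ 3 containing a primitive cube root of unity (and by descent over every field of characteristic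
≠ 3, the point `P₀` being rational); at this N the universal constant `c(9) = −3⁻⁷` (`cN9`) is a unit wherever
3 is, so of M5's printed exceptional set {p ≤ N} ∪ {p ∣ 10(N−3)(N−6)(N²−6N+3)} only p = 3 survives here. The general cell (every n, and r ≥ 2: THEOREM U,
`Z ≅ Spec K[t,η₁..η_{r−1}]/(t⁵,η_l²)`) is a pencil theorem read by two seats and machine-checked; it is NOT
claimed here.

HONEST FRAMING. Local commutative algebra of one explicit 0-dimensional scheme; Lean index of one cell of a
structure theorem about the zero-sum incidence schemes `Y(s;3n)` of the cell's W3 «special fibres» leg. No abelian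
variety, cycle, sheaf or semiregularity map appears; nothing here says that HC, HC_CM or HC_AV holds, and nothing
here is a new case of anything.
-/

namespace Summit.Ventures.HSemireg

namespace ZeroSumQuintuplePointN9

universe u

variable {R : Type u} [CommRing R]

/-! ### The coefficients of a product of three depressed cubics -/

/-- `∏_e (z³ + c_e z + d_e) = z⁹ + e₁(c) z⁷ + e₁(d) z⁶ + e₂(c) z⁵ + (Σ_{e≠e'} c_e d_{e'}) z⁴ + (e₂(d) + e₃(c)) z³
+ (Σ_e d_e c_{e+1} c_{e+2}) z² + (Σ_e c_e d_{e+1} d_{e+2}) z + e₃(d)`: the coefficient dictionary `p₇, …, p₀` of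
the cell (the z⁸-coefficient vanishes because the cubics are depressed). -/
theorem prod_three_depressed_cubics (z c₀ c₁ c₂ d₀ d₁ d₂ : R) :
    (z ^ 3 + c₀ * z + d₀) * (z ^ 3 + c₁ * z + d₁) * (z ^ 3 + c₂ * z + d₂) =
      z ^ 9 + (c₀ + c₁ + c₂) * z ^ 7 + (d₀ + d₁ + d₂) * z ^ 6 + (c₀ * c₁ + c₀ * c₂ + c₁ * c₂) * z ^ 5
        + (c₀ * d₁ + c₀ * d₂ + c₁ * d₀ + c₁ * d₂ + c₂ * d₀ + c₂ * d₁) * z ^ 4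
        + (d₀ * d₁ + d₀ * d₂ + d₁ * d₂ + c₀ * c₁ * c₂) * z ^ 3
        + (d₀ * c₁ * c₂ + d₁ * c₀ * c₂ + d₂ * c₀ * c₁) * z ^ 2
        + (c₀ * d₁ * d₂ + c₁ * d₀ * d₂ + c₂ * d₀ * d₁) * z + d₀ * d₁ * d₂ := by
  ring

/-! ### The dictionary to μ₃-eigencoordinates
`c₀ = γ + x + x'`, `c₁ = γ + ζx + ζ²x'`, `c₂ = γ + ζ²x + ζx'`; `d₀ = (1+y) + β + y'`, `d₁ = ζ(1+y) + β + ζ²y'`,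
`d₂ = ζ²(1+y) + β + ζy'` (ζ² + ζ + 1 = 0). -/

/-- `f₁ = e₁(c) = 3γ` in eigencoordinates. -/
theorem dict_f1 (ζ γ x x' : R) (hζ : ζ ^ 2 + ζ + 1 = 0) :
    (γ + x + x') + (γ + ζ * x + ζ ^ 2 * x') + (γ + ζ ^ 2 * x + ζ * x') = 3 * γ := by
  linear_combination (x + x') * hζ

/-- `f₂ = e₂(c) = 3γ² − 3xx'` in eigencoordinates (the node `xx'` of the configuration curve `{e₁(c) = e₂(c) = 0}`:
its two branches are the two non-trivial eigenlines). -/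
theorem dict_f2 (ζ γ x x' : R) (hζ : ζ ^ 2 + ζ + 1 = 0) :
    (γ + x + x') * (γ + ζ * x + ζ ^ 2 * x') + (γ + x + x') * (γ + ζ ^ 2 * x + ζ * x')
      + (γ + ζ * x + ζ ^ 2 * x') * (γ + ζ ^ 2 * x + ζ * x') = 3 * γ ^ 2 - 3 * x * x' := by
  linear_combination (ζ ^ 2 * x * x' + ζ * x' ^ 2 - ζ * x * x' + ζ * x ^ 2 + 3 * x * x' + 2 * γ * x'
    + 2 * γ * x) * hζ

/-- `f₃ = e₁(d) = 3β` in eigencoordinates. -/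
theorem dict_f3 (ζ β y y' : R) (hζ : ζ ^ 2 + ζ + 1 = 0) :
    ((1 + y) + β + y') + (ζ * (1 + y) + β + ζ ^ 2 * y') + (ζ ^ 2 * (1 + y) + β + ζ * y') = 3 * β := by
  linear_combination (y' + y + 1) * hζ

/-- `f₄ = Σ_{e≠e'} c_e d_{e'} = 6γβ − 3xy' − 3x'(1+y)` in eigencoordinates. -/
theorem dict_f4 (ζ γ x x' β y y' : R) (hζ : ζ ^ 2 + ζ + 1 = 0) :
    (γ + x + x') * (ζ * (1 + y) + β + ζ ^ 2 * y') + (γ + x + x') * (ζ ^ 2 * (1 + y) + β + ζ * y')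
      + (γ + ζ * x + ζ ^ 2 * x') * ((1 + y) + β + y') + (γ + ζ * x + ζ ^ 2 * x') * (ζ ^ 2 * (1 + y) + β + ζ * y')
      + (γ + ζ ^ 2 * x + ζ * x') * ((1 + y) + β + y') + (γ + ζ ^ 2 * x + ζ * x') * (ζ * (1 + y) + β + ζ ^ 2 * y')
      = 6 * γ * β - 3 * x * y' - 3 * x' * (1 + y) := by
  linear_combination (ζ ^ 2 * x' * y + ζ ^ 2 * x * y' + 2 * ζ * x' * y' - ζ * x' * y - ζ * x * y'
    + 2 * ζ * x * y + ζ ^ 2 * x' + 3 * x' * y + 2 * x' * β + 3 * x * y' + 2 * x * β + 2 * γ * y' + 2 * γ * y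
    - ζ * x' + 2 * ζ * x + 3 * x' + 2 * γ) * hζ

/-- `f₅ = e₂(d) + e₃(c) = 3β² − 3(1+y)y' + (γ³ + x³ + x'³ − 3γxx')` in eigencoordinates (`e₃(c)` is the norm form of
the eigencoordinates). -/
theorem dict_f5 (ζ γ x x' β y y' : R) (hζ : ζ ^ 2 + ζ + 1 = 0) :
    ((1 + y) + β + y') * (ζ * (1 + y) + β + ζ ^ 2 * y') + ((1 + y) + β + y') * (ζ ^ 2 * (1 + y) + β + ζ * y')
      + (ζ * (1 + y) + β + ζ ^ 2 * y') * (ζ ^ 2 * (1 + y) + β + ζ * y')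
      + (γ + x + x') * (γ + ζ * x + ζ ^ 2 * x') * (γ + ζ ^ 2 * x + ζ * x')
      = 3 * β ^ 2 - 3 * (1 + y) * y' + γ ^ 3 + x ^ 3 + x' ^ 3 - 3 * γ * x * x' := by
  linear_combination (ζ ^ 2 * x * x' ^ 2 + ζ ^ 2 * x ^ 2 * x' + ζ ^ 2 * γ * x * x' + ζ * x' ^ 3 + ζ * x ^ 3
    + ζ * γ * x' ^ 2 - ζ * γ * x * x' + ζ * γ * x ^ 2 + ζ ^ 2 * y * y' - x' ^ 3 - x ^ 3 + 3 * γ * x * x'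
    + γ ^ 2 * x' + γ ^ 2 * x + ζ * y' ^ 2 - ζ * y * y' + ζ * y ^ 2 + ζ ^ 2 * y' + 3 * y * y' + 2 * β * y'
    + 2 * β * y - ζ * y' + 2 * ζ * y + 3 * y' + 2 * β + ζ) * hζ

/-- `f₆ = e₃(d) − 1 = β³ + (1+y)³ + y'³ − 3β(1+y)y' − 1` in eigencoordinates (norm form). -/
theorem dict_f6 (ζ β y y' : R) (hζ : ζ ^ 2 + ζ + 1 = 0) :
    ((1 + y) + β + y') * (ζ * (1 + y) + β + ζ ^ 2 * y') * (ζ ^ 2 * (1 + y) + β + ζ * y') - 1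
      = β ^ 3 + (1 + y) ^ 3 + y' ^ 3 - 3 * β * (1 + y) * y' - 1 := by
  linear_combination (ζ ^ 2 * y * y' ^ 2 + ζ ^ 2 * y ^ 2 * y' + ζ ^ 2 * β * y * y' + ζ * y' ^ 3 + ζ * y ^ 3
    + ζ * β * y' ^ 2 - ζ * β * y * y' + ζ * β * y ^ 2 + ζ ^ 2 * y' ^ 2 + 2 * ζ ^ 2 * y * y' + ζ ^ 2 * β * y'
    - y' ^ 3 - y ^ 3 + 3 * β * y * y' + β ^ 2 * y' + β ^ 2 * y + 3 * ζ * y ^ 2 - ζ * β * y' + 2 * ζ * β * y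
    + ζ ^ 2 * y' - 3 * y ^ 2 + 3 * β * y' + β ^ 2 + 3 * ζ * y + ζ * β - 3 * y + ζ - 1) * hζ

/-- The coordinate change is invertible when 3 is: `c₀ + c₁ + c₂ = 3γ`, `c₀ + ζ²c₁ + ζc₂ = 3x`,
`c₀ + ζc₁ + ζ²c₂ = 3x'` (inverse discrete Fourier transform over μ₃). -/
theorem dict_inv_c (ζ γ x x' : R) (hζ : ζ ^ 2 + ζ + 1 = 0) :
    (γ + x + x') + (γ + ζ * x + ζ ^ 2 * x') + (γ + ζ ^ 2 * x + ζ * x') = 3 * γ ∧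
    (γ + x + x') + ζ ^ 2 * (γ + ζ * x + ζ ^ 2 * x') + ζ * (γ + ζ ^ 2 * x + ζ * x') = 3 * x ∧
    (γ + x + x') + ζ * (γ + ζ * x + ζ ^ 2 * x') + ζ ^ 2 * (γ + ζ ^ 2 * x + ζ * x') = 3 * x' := by
  refine ⟨?_, ?_, ?_⟩
  · linear_combination (x + x') * hζ
  · linear_combination (ζ ^ 2 * x' - ζ * x' + 2 * ζ * x + x' - 2 * x + γ) * hζ
  · linear_combination (ζ ^ 2 * x + 2 * ζ * x' - ζ * x - 2 * x' + x + γ) * hζ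

/-- Same for the `d`'s: `d₀ + d₁ + d₂ = 3β`, `d₀ + ζ²d₁ + ζd₂ = 3(1+y)`, `d₀ + ζd₁ + ζ²d₂ = 3y'`. -/
theorem dict_inv_d (ζ β y y' : R) (hζ : ζ ^ 2 + ζ + 1 = 0) :
    ((1 + y) + β + y') + (ζ * (1 + y) + β + ζ ^ 2 * y') + (ζ ^ 2 * (1 + y) + β + ζ * y') = 3 * β ∧
    ((1 + y) + β + y') + ζ ^ 2 * (ζ * (1 + y) + β + ζ ^ 2 * y') + ζ * (ζ ^ 2 * (1 + y) + β + ζ * y')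
      = 3 * (1 + y) ∧
    ((1 + y) + β + y') + ζ * (ζ * (1 + y) + β + ζ ^ 2 * y') + ζ ^ 2 * (ζ ^ 2 * (1 + y) + β + ζ * y')
      = 3 * y' := by
  refine ⟨?_, ?_, ?_⟩
  · linear_combination (y' + y + 1) * hζ
  · linear_combination (ζ ^ 2 * y' - ζ * y' + 2 * ζ * y + y' - 2 * y + β + 2 * ζ - 2) * hζ
  · linear_combination (ζ ^ 2 * y + 2 * ζ * y' - ζ * y + ζ ^ 2 - 2 * y' + y + β - ζ + 1) * hζ

/-! ### The solved form: every nearby solution is a polynomial in `x`, and `x⁵ = 0` -/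

/-- SOLVED FORM (the content of THEOREM M5 at N = 9). In a commutative ring in which `3` is a unit (`3·th = 1`)
and `1 + y`, `3 + 3y + y²` are units (automatic in the local ring at the point, where `y` lies in the maximal
ideal), the six equations `f₁ = … = f₆ = 0` in eigencoordinates force `γ = β = y = 0`, `x'² = 0`, `x⁵ = 0`,
`3y' = x³`, `3x' = −x⁴`: the local ring is generated by `x` alone, with `x⁵ = 0`. -/
theorem solved_form (th γ x x' β y y' : R) (h3 : 3 * th = 1) (hu₁ : IsUnit (1 + y))
    (hu₂ : IsUnit (3 + 3 * y + y ^ 2))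
    (F1 : 3 * γ = 0) (F2 : 3 * γ ^ 2 - 3 * x * x' = 0) (F3 : 3 * β = 0)
    (F4 : 6 * γ * β - 3 * x * y' - 3 * x' * (1 + y) = 0)
    (F5 : 3 * β ^ 2 - 3 * (1 + y) * y' + γ ^ 3 + x ^ 3 + x' ^ 3 - 3 * γ * x * x' = 0)
    (F6 : β ^ 3 + (1 + y) ^ 3 + y' ^ 3 - 3 * β * (1 + y) * y' - 1 = 0) :
    γ = 0 ∧ β = 0 ∧ y = 0 ∧ x' ^ 2 = 0 ∧ x ^ 5 = 0 ∧ 3 * y' = x ^ 3 ∧ 3 * x' = -x ^ 4 := by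
  have hγ : γ = 0 := by linear_combination th * F1 - γ * h3
  have hβ : β = 0 := by linear_combination th * F3 - β * h3
  -- the four equations in the remaining coordinates
  have g1 : x * x' = 0 := by linear_combination (-th) * F2 + (3 * th * γ) * hγ - (x * x') * h3
  have g2 : x * y' + x' * (1 + y) = 0 := by
    linear_combination (-th) * F4 + (6 * th * β) * hγ - (x * y' + x' * (1 + y)) * h3
  have g3 : x ^ 3 + x' ^ 3 - 3 * (1 + y) * y' = 0 := by
    linear_combination F5 - (3 * β) * hβ - (γ ^ 2 - 3 * x * x') * hγ
  have g4 : (1 + y) ^ 3 + y' ^ 3 - 1 = 0 := by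
    linear_combination F6 - (β ^ 2 - 3 * (1 + y) * y') * hβ
  -- x'² = 0 :  (1+y)·x'² = x'·(x'(1+y)) = −x x' y' = 0
  have hx'2u : (1 + y) * x' ^ 2 = 0 := by linear_combination x' * g2 - y' * g1
  have hx'2 : x' ^ 2 = 0 := (hu₁.mul_right_eq_zero).mp hx'2u
  -- x⁵ = 0 : an identity in the ideal (no unit needed)
  have hx5 : x ^ 5 = 0 := by
    linear_combination (3 * (1 + y) * x) * g2 - (3 * (1 + y) ^ 2) * g1 + x ^ 2 * g3 - (x * x' ^ 2) * g1
  -- y'³ = 0 :  (3(1+y)y')³ = (x³ + x'³)³ = 0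
  have h27u : (1 + y) ^ 3 * (27 * y' ^ 3) = 0 := by
    linear_combination (-((3 * (1 + y) * y') ^ 2 + (3 * (1 + y) * y') * (x ^ 3 + x' ^ 3)
      + (x ^ 3 + x' ^ 3) ^ 2)) * g3 + x ^ 4 * hx5 + (3 * x ^ 6 * x' + 3 * x ^ 3 * x' ^ 4 + x' ^ 7) * hx'2
  have h27 : 27 * y' ^ 3 = 0 := ((hu₁.pow 3).mul_right_eq_zero).mp h27u
  have hy'3 : y' ^ 3 = 0 := by linear_combination th ^ 3 * h27 - ((9 * th ^ 2 + 3 * th + 1) * y' ^ 3) * h3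
  -- y = 0 :  y(3 + 3y + y²) = −y'³ = 0
  have hyu : (3 + 3 * y + y ^ 2) * y = 0 := by linear_combination g4 - hy'3
  have hy : y = 0 := (hu₂.mul_right_eq_zero).mp hyu
  -- the values
  have hk : 3 * y' = x ^ 3 := by linear_combination (-1 : R) * g3 + x' * hx'2 - (3 * y') * hy
  have hl : 3 * x' = -x ^ 4 := by linear_combination (3 : R) * g2 - x * hk - (3 * x') * hy
  exact ⟨hγ, hβ, hy, hx'2, hx5, hk, hl⟩

/-- Uniqueness: a nearby solution IS the model point at `t = x`, i.e.
`(γ, x, x', β, y, y') = (0, x, −th·x⁴, 0, 0, th·x³)`. -/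
theorem solution_eq_model (th γ x x' β y y' : R) (h3 : 3 * th = 1) (hu₁ : IsUnit (1 + y))
    (hu₂ : IsUnit (3 + 3 * y + y ^ 2))
    (F1 : 3 * γ = 0) (F2 : 3 * γ ^ 2 - 3 * x * x' = 0) (F3 : 3 * β = 0)
    (F4 : 6 * γ * β - 3 * x * y' - 3 * x' * (1 + y) = 0)
    (F5 : 3 * β ^ 2 - 3 * (1 + y) * y' + γ ^ 3 + x ^ 3 + x' ^ 3 - 3 * γ * x * x' = 0)
    (F6 : β ^ 3 + (1 + y) ^ 3 + y' ^ 3 - 3 * β * (1 + y) * y' - 1 = 0) :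
    γ = 0 ∧ x' = -(th * x ^ 4) ∧ β = 0 ∧ y = 0 ∧ y' = th * x ^ 3 ∧ x ^ 5 = 0 := by
  obtain ⟨hγ, hβ, hy, -, hx5, hk, hl⟩ := solved_form th γ x x' β y y' h3 hu₁ hu₂ F1 F2 F3 F4 F5 F6
  refine ⟨hγ, ?_, hβ, hy, ?_, hx5⟩
  · linear_combination th * hl - x' * h3
  · linear_combination th * hk - y' * h3

/-! ### The model point (the Λ-point `Spec K[t]/(t⁵) ↪ Z`) -/

/-- The model point solves `f₁` (trivially: `γ = 0`). -/
theorem model_f1 : 3 * (0 : R) = 0 := by ring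

/-- The model point solves `f₂`: `3·0² − 3·t·(−th t⁴) = 3 th t⁵ = 0`. -/
theorem model_f2 (th t : R) (ht : t ^ 5 = 0) :
    3 * (0 : R) ^ 2 - 3 * t * (-(th * t ^ 4)) = 0 := by
  linear_combination (3 * th) * ht

/-- The model point solves `f₃` (`β = 0`). -/
theorem model_f3 : 3 * (0 : R) = 0 := by ring

/-- The model point solves `f₄`: `−3t·(th t³) − 3(−th t⁴)·1 = 0` identically. -/
theorem model_f4 (th t : R) :
    6 * (0 : R) * 0 - 3 * t * (th * t ^ 3) - 3 * (-(th * t ^ 4)) * (1 + 0) = 0 := by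
  ring

/-- The model point solves `f₅`: `−3·th t³ + t³ + (−th t⁴)³ = 0` from `3 th = 1`, `t⁵ = 0`. -/
theorem model_f5 (th t : R) (h3 : 3 * th = 1) (ht : t ^ 5 = 0) :
    3 * (0 : R) ^ 2 - 3 * (1 + 0) * (th * t ^ 3) + 0 ^ 3 + t ^ 3 + (-(th * t ^ 4)) ^ 3
      - 3 * 0 * t * (-(th * t ^ 4)) = 0 := by
  linear_combination (-(t ^ 7 * th ^ 3)) * ht - t ^ 3 * h3

/-- The model point solves `f₆`: `(1+0)³ + (th t³)³ − 1 = th³ t⁹ = 0`. -/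
theorem model_f6 (th t : R) (ht : t ^ 5 = 0) :
    (0 : R) ^ 3 + (1 + 0) ^ 3 + (th * t ^ 3) ^ 3 - 3 * 0 * (1 + 0) * (th * t ^ 3) - 1 = 0 := by
  linear_combination (t ^ 4 * th ^ 3) * ht

/-- At the model point the two unit hypotheses of `solved_form` hold: `1 + 0` and `3 + 3·0 + 0²` are units
(the latter because `3·th = 1`). -/
theorem model_units (th : R) (h3 : 3 * th = 1) :
    IsUnit (1 + (0 : R)) ∧ IsUnit (3 + 3 * (0 : R) + 0 ^ 2) := by
  refine ⟨by simp, ?_⟩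
  have h : (3 + 3 * (0 : R) + 0 ^ 2) * th = 1 := by linear_combination h3
  exact IsUnit.of_mul_eq_one th h

/-- On the model point `p₁ = Σ_e c_e d_{e+1} d_{e+2} = 3t`
(with `c_e = ζ^e t − ζ^{-e} th t⁴`, `d_e = ζ^e + ζ^{-e} th t³`). -/
theorem model_p1 (ζ th t : R) (hζ : ζ ^ 2 + ζ + 1 = 0) (ht : t ^ 5 = 0) :
    (t + -(th * t ^ 4)) * ((ζ + ζ ^ 2 * (th * t ^ 3)) * (ζ ^ 2 + ζ * (th * t ^ 3)))
      + (ζ * t + ζ ^ 2 * -(th * t ^ 4)) * ((1 + th * t ^ 3) * (ζ ^ 2 + ζ * (th * t ^ 3)))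
      + (ζ ^ 2 * t + ζ * -(th * t ^ 4)) * ((1 + th * t ^ 3) * (ζ + ζ ^ 2 * (th * t ^ 3))) = 3 * t := by
  linear_combination (-3 * ζ * t ^ 10 * th ^ 3 + 3 * t ^ 10 * th ^ 3 - ζ ^ 2 * t ^ 7 * th ^ 2
    + ζ ^ 2 * t ^ 4 * th + 3 * ζ * t - 3 * t) * hζ + (-3 * t ^ 5 * th ^ 3) * ht

/-- On the model point `p₂ = Σ_e d_e c_{e+1} c_{e+2} = 3t²`; with `model_p1`: `p₂ = p₁²/3 = κ·p₁²`,
`κ = 1/3 = (N−3)/(2N)` at `N = 9` — THEOREM M5's forced second-order class. -/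
theorem model_p2 (ζ th t : R) (hζ : ζ ^ 2 + ζ + 1 = 0) (ht : t ^ 5 = 0) :
    (1 + th * t ^ 3) * ((ζ * t + ζ ^ 2 * -(th * t ^ 4)) * (ζ ^ 2 * t + ζ * -(th * t ^ 4)))
      + (ζ + ζ ^ 2 * (th * t ^ 3)) * ((t + -(th * t ^ 4)) * (ζ ^ 2 * t + ζ * -(th * t ^ 4)))
      + (ζ ^ 2 + ζ * (th * t ^ 3)) * ((t + -(th * t ^ 4)) * (ζ * t + ζ ^ 2 * -(th * t ^ 4)))
      = 3 * t ^ 2 := by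
  linear_combination (3 * ζ * t ^ 11 * th ^ 3 - 3 * t ^ 11 * th ^ 3 - ζ ^ 2 * t ^ 8 * th ^ 2
    - ζ ^ 2 * t ^ 5 * th - (-(3 * ζ * t ^ 2)) - 3 * t ^ 2) * hζ + (3 * t ^ 6 * th ^ 3) * ht

/-- THE MODEL POINT AS AN EXPLICIT ZERO-SUM SPLITTING: with `c_e(t) = ζᵉ t − ζ⁻ᵉ th·t⁴`, `d_e(t) = ζᵉ + ζ⁻ᵉ th·t³`
(the eigencoordinates `(γ, x, x', β, y, y') = (0, t, −th t⁴, 0, 0, th t³)`; `ζ⁻¹ = ζ²`), in any commutative ring with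
`ζ² + ζ + 1 = 0`, `3·th = 1`, `t⁵ = 0`:  `∏_e (z³ + c_e(t) z + d_e(t)) = z⁹ + 3t²·z² + 3t·z + 1` — an `R[t]/(t⁵)`-point of
the slice `Z` (`p₀ = 1`, `p₃ = … = p₈ = 0`) through `P₀ = z⁹ + 1` with `x = t`, `p₁ = 3t`, `p₂ = 3t² = p₁²/3`. -/
theorem model_product (z ζ th t : R) (hζ : ζ ^ 2 + ζ + 1 = 0) (h3 : 3 * th = 1) (ht : t ^ 5 = 0) :
    (z ^ 3 + (t - t ^ 4 * th) * z + (1 + t ^ 3 * th)) * (z ^ 3 + (ζ * t - ζ ^ 2 * t ^ 4 * th) * z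
      + (ζ + ζ ^ 2 * t ^ 3 * th)) * (z ^ 3 + (ζ ^ 2 * t - ζ * t ^ 4 * th) * z + (ζ ^ 2 + ζ * t ^ 3 * th))
      = z ^ 9 + 3 * t ^ 2 * z ^ 2 + 3 * t * z + 1 := by
  linear_combination (-(z ^ 3 * ζ * t ^ 12 * th ^ 3) + z ^ 3 * t ^ 12 * th ^ 3 + 3 * z ^ 2 * ζ * t ^ 11 * th ^ 3
    - 3 * z ^ 2 * t ^ 11 * th ^ 3 + z ^ 3 * ζ ^ 2 * t ^ 9 * th ^ 2 + z ^ 5 * ζ * t ^ 8 * th ^ 2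
    - 3 * z * ζ * t ^ 10 * th ^ 3 + 3 * z * t ^ 10 * th ^ 3 - z ^ 2 * ζ ^ 2 * t ^ 8 * th ^ 2
    - 2 * z ^ 4 * ζ * t ^ 7 * th ^ 2 + ζ * t ^ 9 * th ^ 3 - z ^ 5 * ζ ^ 2 * t ^ 5 * th - t ^ 9 * th ^ 3
    - z * ζ ^ 2 * t ^ 7 * th ^ 2 + z ^ 3 * ζ * t ^ 6 * th ^ 2 - z ^ 3 * ζ ^ 2 * t ^ 6 * th + z ^ 5 * ζ * t ^ 5 * th
    - z ^ 7 * t ^ 4 * th - 3 * z ^ 5 * t ^ 5 * th + ζ ^ 2 * t ^ 6 * th ^ 2 - z ^ 2 * ζ ^ 2 * t ^ 5 * th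
    + z ^ 6 * t ^ 3 * th + z ^ 3 * ζ ^ 2 * t ^ 3 * th + z * ζ ^ 2 * t ^ 4 * th - z ^ 3 * ζ * t ^ 3 * th
    + z ^ 5 * ζ * t ^ 2 + z ^ 7 * t + 3 * z ^ 3 * t ^ 3 * th + z ^ 3 * ζ * t ^ 3 + ζ ^ 2 * t ^ 3 * th - z ^ 3 * t ^ 3
    + 2 * z ^ 4 * ζ * t + z ^ 6 + 3 * z ^ 2 * ζ * t ^ 2 - 3 * z ^ 2 * t ^ 2 + z ^ 3 * ζ + 3 * z * ζ * t - 3 * z * t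
    + ζ - 1) * hζ
    + (-(z ^ 3 * t ^ 7 * th ^ 3) + 3 * z ^ 2 * t ^ 6 * th ^ 3 - 3 * z * t ^ 5 * th ^ 3 + t ^ 4 * th ^ 3
    + 3 * z ^ 5 * th) * ht + (-(z ^ 3 * t ^ 3)) * h3

/-- `κ(N) = (N − 3)/(2N)` of THEOREM M5 at `N = 9` is `1/3` (arithmetic). -/
theorem kappa_N9 : ((9 : ℚ) - 3) / (2 * 9) = 1 / 3 := by norm_num

/-- `c(N) = −(N−3)(N−6)(N²−6N+3)/(20N⁵)` of THEOREM M5 at `N = 9` is `−1/3⁷ = −1/2187`: a unit wherever 3 is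
(arithmetic; so at N = 9 only the prime 3 is exceptional). -/
theorem cN9 : -(((9 : ℚ) - 3) * (9 - 6) * (9 ^ 2 - 6 * 9 + 3)) / (20 * 9 ^ 5) = -1 / 2187 := by norm_num

/-! ### Non-vacuity: an honest order-4 splitting in `ℤ/7⁵` -/

/-- NON-VACUITY (by `decide`). In `ℤ/7⁵` (where `3·11205 = 1`, `ζ = 1353` satisfies `ζ² + ζ + 1 = 0`, and
`t = 7` has `t⁵ = 0 ≠ t⁴`) the model configuration `c = (4809, 11872, 126)`, `d = (11320, 3411, 2076)` satisfies
the six equations `e₁(c) = e₂(c) = e₁(d) = Σ_{e≠e'} c_e d_{e'} = e₂(d) + e₃(c) = 0`, `e₃(d) = 1`, with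
`p₁ = 21 = 3t` and `p₂ = 147 = 3t²`: by `prod_three_depressed_cubics`,
`∏_e (z³ + c_e z + d_e) = z⁹ + 147 z² + 21 z + 1` in `(ℤ/7⁵)[z]` — a zero-sum splitting whose parameter has
`t⁴ ≠ 0` (indeed `p₁⁴ = 21⁴ ≠ 0`), so no equation of order ≤ 4 in `p₁` holds on `Z` (length ≥ 5 is witnessed,
not only derived). -/
theorem witness_mod_7_pow_5 :
    let c₀ : ZMod 16807 := 4809
    let c₁ : ZMod 16807 := 11872
    let c₂ : ZMod 16807 := 126
    let d₀ : ZMod 16807 := 11320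
    let d₁ : ZMod 16807 := 3411
    let d₂ : ZMod 16807 := 2076
    (3 : ZMod 16807) * 11205 = 1 ∧ (1353 : ZMod 16807) ^ 2 + 1353 + 1 = 0 ∧
    (7 : ZMod 16807) ^ 5 = 0 ∧ (7 : ZMod 16807) ^ 4 ≠ 0 ∧ (3 * 7 : ZMod 16807) ^ 4 ≠ 0 ∧
    c₀ + c₁ + c₂ = 0 ∧ c₀ * c₁ + c₀ * c₂ + c₁ * c₂ = 0 ∧ d₀ + d₁ + d₂ = 0 ∧
    c₀ * d₁ + c₀ * d₂ + c₁ * d₀ + c₁ * d₂ + c₂ * d₀ + c₂ * d₁ = 0 ∧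
    d₀ * d₁ + d₀ * d₂ + d₁ * d₂ + c₀ * c₁ * c₂ = 0 ∧ d₀ * d₁ * d₂ = 1 ∧
    c₀ * d₁ * d₂ + c₁ * d₀ * d₂ + c₂ * d₀ * d₁ = 3 * 7 ∧
    d₀ * c₁ * c₂ + d₁ * c₀ * c₂ + d₂ * c₀ * c₁ = 3 * 7 ^ 2 := by
  decide

end ZeroSumQuintuplePointN9

end Summit.Ventures.HSemireg
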